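import Literature.MathematicalPhysics.QuantumFieldTheory.Balaban1983to89.B1Eq220ZeroFieldTorusLevels

/-!
# `Balaban1983to89.B1Ineq225ZeroFieldTorusLevels` — T. Bałaban, *(Higgs)₂,₃ quantum fields in a finite volume. I. A lower bound*,
# Commun. Math. Phys. **85** (1982) 603–626 [Balaban1982Higgs1]: Prop. 2.1 (2.25), value clause WITH ITS DECAY FACTOR —
# `|(G^ε_k(T_ε,0)f)(x)| ≦ c₀(L^kε)² exp(−δ₀(L^kε)^{−1}dist(x, supp f))‖f‖_∞` — PROVED FOR THE (Higgs)₂,₃ MODEL AT ZERO FIELD AT EVERY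
# LEVEL `1 ≦ k ≦ K`, every coupling, every `N`, with ONE pair `δ₀, c₀` for all volumes of the torus sub-family `M·L′_μ = L^m`, all levels and
# all `L^kε ≦ ε₀` (from B4's Theorem (1.10) on the torus, p38's `B4Thm110ZeroTorus`); plus the finite Schur test behind [B4] Cor. 2.3

statement-level skeleton of published theorems with citation tags; proofs where landed; nothing here is a claim about the Yang–Mills mass gap

PDF held: `paper:balaban1982-cmp85-higgs23-i` (journal page = PDF page + 602); p. 604 [PDF 2] ((1.3), (1.5)), p. 610 [PDF 8] (Prop. 2.1
(2.24)–(2.25), (2.20), (2.22)), p. 617 [PDF 15] ((3.27)–(3.29)), p. 621 [PDF 19] ((3.53)), p. 625 [PDF 23] ((3.67)); ×2 renders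
`run/shared/lean/pub/pub-balaban/b2b-balaban-ref1/pages/1982-cmp85-higgs23-I/1982-cmp85-higgs23-I-p002|p008|p015|p019|p023-x2.png`; B4 =
[Balaban1983RegularityDecay] p. 573 [PDF 3] (Theorem (1.10)), p. 580 [PDF 10] (Cor. 2.3 (2.30)), held `paper:balaban1983-cmp89-regularity-decay`.

CITATION HEADER (lean-in-tree rule).  Cell `lit-balaban` (HOME `run/shared/lean/pub/lit-balaban/`), Phase-2 proof seat **p14** gen 9 (unit
`lit-balaban-p14`), file 3 of four (`B1Eq211ZeroFieldTorusLevels`, `B1Eq220ZeroFieldTorusLevels`, this, `B1Cor23ZeroFieldTorus`); SKELETON rows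
**B1.Prop2.1** ((2.25) value clause with decay, `A = 0`, torus, every level: MODEL INSTANCE on the (Higgs)₂,₃ carrier), **B1.Eq3.53** /
**B1.Eq3.66–3.67** (the level-`k` sup bound `hG` / `hGv`, r12), **B1.Eq3.27** (`χ_k(A) = 1` on the small-field set).  USED BY NAME, never
restated: p38's `B4Thm110ZeroTorus.{value_row_bound, kerBounds_torus, cTerm}`, gen 8's `B1Ineq225ZeroFieldTorus.{G0unit_decay_cap,
norm_le_sqrt_mul}` (whose `torus_sup_bound`/`propagatorK_sup_bound` are the case `D = 0`, `k = K` of §1–§2), `B5Leaf237C0Torus.{gamma0, dK0}`,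
`B5Ineq137Torus.T`, this seat's files 1–2 (`setupAt`, `eSiteAt`, `cmpAt`, `propagatorK_zero_apply_at`, `T_eq_tdist_symm`), the typer's
`HiggsLattice.Site.tdist` ((1.3)), `HiggsCovariance.propagatorK`, r14/gen 8's `B1Ineq367SmallField.chiKA_eq_one_of_small`.

WHAT IS PRINTED (verbatim).  p. 610 [PDF 8], Prop. 2.1: *"there exist constants δ₀ > 0, c₀, such that … |(G^ε_k(Ω,A)f)(x)| ≦ c₀(L^kε)²
exp(−δ₀(L^kε)^{−1} dist(x, supp f)) sup_x|f(x)| … (2.25) … The constants in the above inequalities depend on d, a, M, α only"* ⟦the display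
is partly illegible on the held scan; the factor `(L^kε)²`, the exponential and the sup norm are legible⟧; B4 p. 573 [PDF 3], Theorem:
*"|(G_k(Ω,A)f)(x)| ≦ c₀exp(−δ₀dist(x, supp f))‖f‖_∞ (1.10)"*; B4 p. 580 [PDF 10]: *"Let us notice that this lemma alone implies a weaker version
of Proposition I.2.1 with L²-norms"* (Remark before Corollary 2.3).

WHAT THIS FILE PROVES (kernel-checked, zero `sorry`, theorems only; axioms standard).
* §1 **B4 (1.10) ON THE TORUS, VALUE CLAUSE WITH DECAY, TOP LEVEL, UNIFORM UNDER A MASS CAP**: `torus_decay_bound` — ONE `δ₀, c₀ > 0` with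
  `|(G_Kf)(x)| ≦ c₀e^{−δ₀εD}F` for every volume `(m, K ≧ 1)` of Bałaban's scalar torus tower, every mass `0 ≦ m² ≦ m₊²`, every `f` with
  `|f| ≦ F` vanishing within fine sup-distance `D ≧ 0` of `x` (`δ₀ = min(dK0/2, δ/4)` from p38's kernel inputs).
* §2 **(2.25) FOR THE MODEL AT `A = 0`, EVERY LEVEL**: `propagatorK_decay_bound` — for `d ≧ 1`, odd `L > 1`, `a > 0`, `m² ≧ 0`, `ε₀`, `N` there
  are `δ₀, c₀ > 0` with `‖(G^ε_k(T_ε,0)g)(x)‖ ≦ c₀(L^kε)²e^{−δ₀D/L^k}M` on every torus of the sub-family, every coupling, every `1 ≦ k ≦ K` with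
  `L^kε ≦ ε₀`, every `g` with `‖g‖ ≦ M` vanishing within (1.3)-distance `D` (lattice units of `T_ε`) of `x` — `D/L^k = (L^kε)^{−1}·(εD)` is
  the printed exponent; `propagatorK_sup_bound_at` (`D = 0`: the level-`k` input `hG` of `B1Eq353SupNorm.norm_bgScalar_le` (background `0`)
  and `hGv` of `B1Ineq367SmallField`, SHARP factor `(L^kε)²`); `chiKA_eq_one_of_small_torus_at` ((3.27)'s `χ_k(A) = 1` on the small-field
  set at every level with no displayed input).
* §3 the `L²` MECHANISM of the Remark before [B4] Cor. 2.3 as finite lemmas: `abs_sum_mul_le_of_rowcol` (Schur's test), `rowSum_abs_le`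
  (a support-restricted row of `|G|` is bounded by the sup-norm bound on sign test functions), `abs_dot_mulVec_le` (`|⟨u, Gv⟩| ≦ B‖u‖₂‖v‖₂`
  from support-localised row/column bounds) — consumed by file 4 `B1Cor23ZeroFieldTorus`.
HONEST SCOPE: `A = 0` (hence any coupling), `Ω = T_ε`, tori with `M·L′_μ = L^m` and `L` odd (gen 8's `Shape`), levels `1 ≦ k ≦ K`; constants
existential (functions of `d, L, a, m²ε₀², N`; the `√N` from reading `ℝ^N` componentwise), no numerical values; distance = the sup torus
distance (1.3) in lattice units; the Hölder clause (2.24) and the derivative clause of (2.25) are not transported here (`B4Thm19ZeroTorus`,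
`B4Thm110ZeroTorus.deriv_row_bound` carry them on `Setup`'s carrier); background fields `A ≠ 0` are NOT covered.  Unit `lit-balaban-p14` gen 9
(literature-prover-lit-balaban-p14-g9-0).
-/

open scoped BigOperators
open Matrix

namespace Literature.MathematicalPhysics.QuantumFieldTheory.Balaban1983to89.B1Ineq225ZeroFieldTorusLevels

open Literature.MathematicalPhysics.QuantumFieldTheory.Balaban1983to89.HiggsLattice (ChargeData)
open Literature.MathematicalPhysics.QuantumFieldTheory.Balaban1983to89.HiggsCovariance (propagatorK)
open Literature.MathematicalPhysics.QuantumFieldTheory.Balaban1983to89.B3MultiscaleFields (zeroCharge toSite)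
open Literature.MathematicalPhysics.QuantumFieldTheory.Balaban1983to89.B1Eq31Concrete (chiKA thrF)
open Literature.MathematicalPhysics.QuantumFieldTheory.Balaban1983to89.B1RG242Torus (tower)
open Literature.MathematicalPhysics.QuantumFieldTheory.Balaban1983to89.B5Display136Torus (G0unit)
open Literature.MathematicalPhysics.QuantumFieldTheory.Balaban1983to89.B5Ineq137Torus (T T_nonneg)
open Literature.MathematicalPhysics.QuantumFieldTheory.Balaban1983to89.B5Leaf237C0Torus (gamma0 dK0 gamma0_pos dK0_pos)
open Literature.MathematicalPhysics.QuantumFieldTheory.Balaban1983to89.B4Thm110ZeroTorus (KerBounds cTerm cTerm_nonneg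
  value_row_bound kerBounds_torus)
open Literature.MathematicalPhysics.QuantumFieldTheory.Balaban1983to89.B1Eq211ZeroFieldTorus (Shape)
open Literature.MathematicalPhysics.QuantumFieldTheory.Balaban1983to89.B1Ineq225ZeroFieldTorus (G0unit_decay_cap norm_le_sqrt_mul)
open Literature.MathematicalPhysics.QuantumFieldTheory.Balaban1983to89.B1Eq211ZeroFieldTorusLevels (setupAt setupAt_d setupAt_L
  eSiteAt cmpAt cmpAt_apply cmpAt_apply_eSiteAt)
open Literature.MathematicalPhysics.QuantumFieldTheory.Balaban1983to89.B1Eq220ZeroFieldTorusLevels (propagatorK_zero_apply_at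
  T_eq_tdist_symm)
open Literature.MathematicalPhysics.QuantumFieldTheory.Balaban1983to89.B1Ineq367SmallField (chiKA_eq_one_of_small)

variable {P : HiggsLattice.Params}
/-! ## §1 B4 (1.10) on the torus: the value clause with its decay factor, top level, uniform under a mass cap -/

section Torus

/-- **B4 THEOREM (1.10) ON THE TORUS, VALUE CLAUSE WITH DECAY, TOP LEVEL, UNIFORM**: for `d ≧ 1`, odd `L > 1`, `a > 0` and a mass cap
`m₊² ≧ 0` there are `δ₀, c₀ > 0` with `|(G_Kf)(x)| ≦ c₀e^{−δ₀·εD}·F` for every volume `(m, K)` of Bałaban's scalar torus tower with `K ≧ 1`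
(top level = unit lattice, `G_K = G_K(T, 0)` of B4 (1.6), `ε = L^{−K}`), every mass `0 ≦ m² ≦ m₊²`, every site `x` and every `f` with `|f| ≦ F`
vanishing within fine sup-distance `D ≧ 0` of `x` — p38's `value_row_bound` with the volume-uniform kernel inputs `kerBounds_torus` and gen 8's
mass-capped `G0unit_decay_cap`; `δ₀ = min(dK0/2, δ/4)`. [cite: Balaban1983RegularityDecay, Theorem (1.10) p.573; (2.34)–(2.39) p.582] -/
theorem torus_decay_bound (d L : ℕ) (hd : 1 ≤ d) (hL : Odd L ∧ 1 < L) {a : ℝ} (ha : 0 < a) {m2plus : ℝ} (hm2 : 0 ≤ m2plus) :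
    ∃ δ₀ c₀ : ℝ, 0 < δ₀ ∧ 0 < c₀ ∧ ∀ (Q : Params), Q.d = d → Q.L = L → 1 ≤ Q.K → ∀ (msq : ℝ), 0 ≤ msq → msq ≤ m2plus →
      ∀ (x : Site Q 0) (f : Site Q 0 → ℝ) (F D : ℝ), (∀ z, |f z| ≤ F) → 0 ≤ D → (∀ z, f z ≠ 0 → D ≤ T Q 0 x z) →
        |((tower Q a msq).G Q.K *ᵥ f) x| ≤ c₀ * Real.exp (-(δ₀ * (Q.eps * D))) * F := by
  obtain ⟨C, δ, hC, hδ, hKB⟩ := kerBounds_torus d L hd hL ha m2plus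
  obtain ⟨P₀, hP₀d, hP₀L⟩ : ∃ P₀ : Params, P₀.d = d ∧ P₀.L = L := ⟨⟨d, L, 0, 0, hd, hL⟩, rfl, rfl⟩
  have hγ : 0 < gamma0 L a := by rw [← hP₀L]; exact gamma0_pos (P := P₀) ha
  have hδK : 0 < dK0 d L a m2plus := by rw [← hP₀d, ← hP₀L]; exact dK0_pos (P := P₀) ha hm2
  have hL1 : (1 : ℝ) < L := by exact_mod_cast hL.2
  have h1 := B4Sect5Proof.latticeConst_nonneg d (show 0 ≤ dK0 d L a m2plus / 2 by positivity)
  have h2 := cTerm_nonneg d hC hδ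
  have h3 : 0 ≤ 1 / ((L : ℝ) - 1) := div_nonneg zero_le_one (by linarith)
  have hC₀ : 0 ≤ 2 / gamma0 L a := (div_pos two_pos hγ).le
  refine ⟨min (dK0 d L a m2plus / 2) (δ / 4),
    2 / gamma0 L a * B4Sect5Proof.latticeConst d (dK0 d L a m2plus / 2) + a ^ 2 * cTerm d C δ * (1 / ((L : ℝ) - 1)) + 1,
    lt_min (by positivity) (by positivity), by positivity, ?_⟩
  intro Q hQd hQL hK1 msq hmsq hcap x f F D hF hD0 hD
  have hkm : Q.K ≤ Q.m + Q.K := Nat.le_add_left _ _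
  have hcapK : Q.spacing Q.K ^ 2 * msq ≤ m2plus := by rw [Q.spacing_K, one_pow, one_mul]; exact hcap
  have hKB' : KerBounds Q a msq Q.K C δ := hKB Q hQd hQL msq hmsq Q.K hkm hcapK
  subst hQd hQL
  have hG0 : ∀ y y' : Site Q 0, |G0unit Q a msq y y'| ≤ 2 / gamma0 Q.L a * Real.exp (-(dK0 Q.d Q.L a m2plus * T Q 0 y y')) :=
    fun y y' => G0unit_decay_cap ha hmsq hcap y y'
  have hF0 : 0 ≤ F := (abs_nonneg _).trans (hF x)
  have h := value_row_bound Q ha hmsq hK1 le_rfl hkm hC hδ hC₀ hδK hKB' hG0 x f hF hD0 hD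
  refine h.trans (mul_le_mul_of_nonneg_right (mul_le_mul_of_nonneg_right ?_ (Real.exp_nonneg _)) hF0)
  linarith

end Torus

/-! ## §2 (2.25) for the model's propagator `G^ε_k(T_ε, 0)`, every level `1 ≦ k ≦ K`, every coupling, every `N` -/

section Model

/-- The components of an `ℝ^N`-valued field are bounded by its pointwise Euclidean norm. [cite: Balaban1982Higgs1, (1.5) p.604] -/
theorem abs_cmpAt_le (S : Shape P) {k : ℕ} (hk : k ≤ P.K) {N : ℕ} {g : HiggsLattice.ScalarField P 0 N} {M : ℝ}
    (hg : ∀ x, ‖g x‖ ≤ M) (i : Fin N) (z : Site (setupAt S k) 0) : |cmpAt S hk i g z| ≤ M := by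
  rw [cmpAt_apply, ← Real.norm_eq_abs]
  exact (PiLp.norm_apply_le _ i).trans (hg _)

/-- `setupAt`'s fine spacing times a fine distance: `L^{−k}·D = D/L^k`. [cite: Balaban1982Higgs1, (1.19) p.607] -/
theorem eps_setupAt_mul (S : Shape P) (k : ℕ) (D : ℝ) : (setupAt S k).eps * D = D / (P.L : ℝ) ^ k := by
  show ((P.L : ℝ)⁻¹) ^ k * D = D / (P.L : ℝ) ^ k
  rw [inv_pow, div_eq_inv_mul]

/-- **PROP. 2.1 (2.25), VALUE CLAUSE WITH ITS DECAY FACTOR, FOR THE (Higgs)₂,₃ MODEL AT `A = 0`, EVERY LEVEL — PROVED, UNIFORMLY**: for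
`d ≧ 1`, odd `L > 1`, `a > 0`, `m² ≧ 0`, any `ε₀` and any `N` there are `δ₀, c₀ > 0` (functions of `d, L, a, m²ε₀², N`: *"The constants …
depend on d, a, M, α only"*) such that on EVERY torus `T_ε` of the sub-family `M·L′_μ = L^m`, for every coupling `C`, every `1 ≦ k ≦ K` with
`L^kε ≦ ε₀`, every `g : T_ε → ℝ^N` with `‖g‖ ≦ M` vanishing within (1.3)-distance `D ≧ 0` (lattice units of `T_ε`) of `x`:
`‖(G^ε_k(T_ε,0)g)(x)‖ ≦ c₀(L^kε)²e^{−δ₀D/L^k}M` — and `D/L^k = (L^kε)^{−1}·(εD)` is the printed `(L^kε)^{−1}dist(x, supp g)`.  Route: file 2's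
`propagatorK_zero_apply_at` + §1 on `setupAt S k` (mass `m²(L^kε)² ≦ m²ε₀²`) + `‖v‖ ≦ √N·max_i|v_i|`.
[cite: Balaban1982Higgs1, Prop. 2.1 (2.25) p.610; (2.22) p.610] -/
theorem propagatorK_decay_bound (d L N : ℕ) (hd : 1 ≤ d) (hL : Odd L ∧ 1 < L) {a : ℝ} (ha : 0 < a) {msq : ℝ} (hmsq : 0 ≤ msq)
    (ε₀ : ℝ) :
    ∃ δ₀ c₀ : ℝ, 0 < δ₀ ∧ 0 < c₀ ∧ ∀ (P : HiggsLattice.Params) (S : Shape P), P.d = d → P.L = L →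
      ∀ (C : ChargeData N) {k : ℕ}, 1 ≤ k → k ≤ P.K → P.mesh k ≤ ε₀ →
        ∀ (g : HiggsLattice.ScalarField P 0 N) (M D : ℝ), (∀ x, ‖g x‖ ≤ M) → 0 ≤ D →
          ∀ x, (∀ z, g z ≠ 0 → D ≤ (HiggsLattice.Site.tdist x z : ℝ)) →
            ‖propagatorK C Finset.univ (0 : HiggsLattice.VecField P 0) msq a k g x‖
              ≤ c₀ * P.mesh k ^ 2 * Real.exp (-(δ₀ * (D / (P.L : ℝ) ^ k))) * M := by
  obtain ⟨δ₀, c, hδ₀, hc, hG⟩ := torus_decay_bound d L hd hL ha (show 0 ≤ msq * ε₀ ^ 2 by positivity)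
  have hN0 : 0 ≤ Real.sqrt N := Real.sqrt_nonneg _
  refine ⟨δ₀, (Real.sqrt N + 1) * c, hδ₀, mul_pos (by positivity) hc, ?_⟩
  intro P S hPd hPL C k hk1 hk hε g M D hg hD0 x hD
  have hℓ := P.mesh_pos k
  have hM : 0 ≤ M := (norm_nonneg _).trans (hg x)
  have hcap : msq * P.mesh k ^ 2 ≤ msq * ε₀ ^ 2 := mul_le_mul_of_nonneg_left (pow_le_pow_left₀ hℓ.le hε 2) hmsq
  have hE := Real.exp_nonneg (-(δ₀ * (D / (P.L : ℝ) ^ k)))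
  -- the support condition read on the level-`k` torus
  have hDS : ∀ (i : Fin N) (z : Site (setupAt S k) 0), cmpAt S hk i g z ≠ 0 →
      D ≤ T (setupAt S k) 0 (eSiteAt S hk (Nat.zero_le _) x) z := by
    intro i z hz
    rw [T_eq_tdist_symm S hk (Nat.zero_le _), Equiv.symm_apply_apply]
    refine hD _ fun h0 => hz ?_
    rw [cmpAt_apply, h0]
    rfl
  have hcomp : ∀ i : Fin N,
      |(propagatorK C Finset.univ (0 : HiggsLattice.VecField P 0) msq a k g x) i|
        ≤ P.mesh k ^ 2 * (c * Real.exp (-(δ₀ * (D / (P.L : ℝ) ^ k))) * M) := by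
    intro i
    rw [propagatorK_zero_apply_at S hk C hk1 ha hmsq, abs_mul, abs_of_pos (pow_pos hℓ 2)]
    refine mul_le_mul_of_nonneg_left ?_ (pow_pos hℓ 2).le
    have h := hG (setupAt S k) hPd hPL hk1 (msq * P.mesh k ^ 2) (mul_nonneg hmsq (sq_nonneg _)) hcap
      (eSiteAt S hk (Nat.zero_le _) x) (cmpAt S hk i g) M D (abs_cmpAt_le S hk hg i) hD0 (fun z hz => hDS i z hz)
    rwa [eps_setupAt_mul] at h
  calc ‖propagatorK C Finset.univ (0 : HiggsLattice.VecField P 0) msq a k g x‖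
      ≤ Real.sqrt N * (P.mesh k ^ 2 * (c * Real.exp (-(δ₀ * (D / (P.L : ℝ) ^ k))) * M)) :=
        norm_le_sqrt_mul _ (by positivity) hcomp
    _ ≤ (Real.sqrt N + 1) * (P.mesh k ^ 2 * (c * Real.exp (-(δ₀ * (D / (P.L : ℝ) ^ k))) * M)) :=
        mul_le_mul_of_nonneg_right (by linarith) (by positivity)
    _ = (Real.sqrt N + 1) * c * P.mesh k ^ 2 * Real.exp (-(δ₀ * (D / (P.L : ℝ) ^ k))) * M := by ring

/-- **(2.25), SUP-NORM CLAUSE, EVERY LEVEL, SHARP FACTOR `(L^kε)²`** (the case `D = 0` of `propagatorK_decay_bound`): one `c₀ > 0` with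
`‖(G^ε_k(T_ε,0)g)(x)‖ ≦ c₀(L^kε)²M` for every torus of the sub-family, every coupling, every `1 ≦ k ≦ K` with `L^kε ≦ ε₀`, every `‖g‖ ≦ M` —
exactly the input `hG` (background `0`) of `B1Eq353SupNorm.norm_bgScalar_le` / `hGv` of `B1Ineq367SmallField.chiKA_eq_one_of_small` at
level `k` (gen 8's `propagatorK_sup_bound` is the top level `k = K`). [cite: Balaban1982Higgs1, Prop. 2.1 (2.25) p.610] -/
theorem propagatorK_sup_bound_at (d L N : ℕ) (hd : 1 ≤ d) (hL : Odd L ∧ 1 < L) {a : ℝ} (ha : 0 < a) {msq : ℝ} (hmsq : 0 ≤ msq)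
    (ε₀ : ℝ) :
    ∃ c₀ : ℝ, 0 < c₀ ∧ ∀ (P : HiggsLattice.Params) (_S : Shape P), P.d = d → P.L = L →
      ∀ (C : ChargeData N) {k : ℕ}, 1 ≤ k → k ≤ P.K → P.mesh k ≤ ε₀ →
        ∀ (g : HiggsLattice.ScalarField P 0 N) (M : ℝ), (∀ x, ‖g x‖ ≤ M) →
          ∀ x, ‖propagatorK C Finset.univ (0 : HiggsLattice.VecField P 0) msq a k g x‖ ≤ c₀ * P.mesh k ^ 2 * M := by
  obtain ⟨δ₀, c₀, _, hc₀, h⟩ := propagatorK_decay_bound d L N hd hL ha hmsq ε₀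
  refine ⟨c₀, hc₀, fun P S hPd hPL C k hk1 hk hε g M hg x => ?_⟩
  have h' := h P S hPd hPL C hk1 hk hε g M 0 hg le_rfl x (fun z _ => Nat.cast_nonneg _)
  simpa only [zero_div, mul_zero, neg_zero, Real.exp_zero, mul_one] using h'

/-- **THE VECTOR-FIELD HALF OF (3.67)/(3.53)'s (H1) WITH NO DISPLAYED INPUT, EVERY LEVEL**: on the torus sub-family, for `d ≧ 1`, odd `L > 1`,
`a > 0`, `μ₀² > 0`, any `ε₀`, with the `c₀` of `propagatorK_sup_bound_at` (`N = d`): for every `1 ≦ k ≦ K` with `L^kε ≦ ε₀` and every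
`c₁ ≧ a_k(c₀ + 1 + μ₀²c₀(L^kε)² + a_kc₀)`, `χ_k(A) = 1` ((3.27), thresholds `L^kε`, `p`) whenever `|A(x)| ≦ c₁^{−1}(L^kε)^{−(d−2)/2}p` at every
site — `B1Ineq367SmallField.chiKA_eq_one_of_small` at level `k` with its input `hGv` supplied (gen 8's `chiKA_eq_one_of_small_torus` is `k = K`).
[cite: Balaban1982Higgs1, (3.67) p.625; (3.27) p.617; Prop. 2.1 (2.25) p.610] -/
theorem chiKA_eq_one_of_small_torus_at (d L : ℕ) (hd : 1 ≤ d) (hL : Odd L ∧ 1 < L) {a : ℝ} (ha : 0 < a) {mu0sq : ℝ}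
    (hmu : 0 < mu0sq) (ε₀ : ℝ) :
    ∃ c₀ : ℝ, 0 < c₀ ∧ ∀ (P : HiggsLattice.Params) (_S : Shape P), P.d = d → P.L = L → ∀ {k : ℕ}, 1 ≤ k → k ≤ P.K →
      P.mesh k ≤ ε₀ → ∀ (c₁ : ℝ), 0 < c₁ → B1.aSeq a P.L k * (c₀ + 1 + mu0sq * c₀ * P.mesh k ^ 2 + B1.aSeq a P.L k * c₀) ≤ c₁ →
        ∀ (p : ℝ) (A : HiggsLattice.VecField P k), (∀ x, ‖toSite A x‖ ≤ c₁⁻¹ * thrF P.d (P.mesh k) p) →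
          chiKA (P.mesh k) p mu0sq a k A = 1 := by
  obtain ⟨c₀, hc₀, hGv⟩ := propagatorK_sup_bound_at d L d hd hL ha hmu.le ε₀
  refine ⟨c₀, hc₀, fun P S hPd hPL k hk1 hk hε c₁ hc₁0 hc₁ p A hA => ?_⟩
  have hL1 : (1 : ℝ) < P.L := by rw [hPL]; exact_mod_cast hL.2
  subst hPd
  exact chiKA_eq_one_of_small hk hmu (B1.aSeq_pos ha hL1 hk1).le hc₀.le hc₁0 hc₁
    (fun g M hg y => hGv P S rfl hPL (zeroCharge P.d) hk1 hk hε g M hg y) hA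

end Model

/-! ## §3 The `L²` mechanism of the Remark before [B4] Cor. 2.3: a finite Schur test (tools for `B1Cor23ZeroFieldTorus`) -/

section Schur

/-- **Schur test, finite form**: a kernel `K ≧ 0` on a finite index set with row sums and column sums `≦ B` satisfies
`Σ_{i,j}|u_i|K_{ij}|v_j| ≦ B(Σu²)^{1/2}(Σv²)^{1/2}` (Cauchy–Schwarz on `(|u_i|K^{1/2})(K^{1/2}|v_j|)`) — the *"L²-bounds"* mechanism of the
Remark before Cor. 2.3. [cite: Balaban1983RegularityDecay, Corollary 2.3 (2.30) p.580] -/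
theorem abs_sum_mul_le_of_rowcol {ι : Type*} [Fintype ι] (K : ι → ι → ℝ) (hK : ∀ i j, 0 ≤ K i j) {B : ℝ} (hB : 0 ≤ B)
    (hrow : ∀ i, ∑ j, K i j ≤ B) (hcol : ∀ j, ∑ i, K i j ≤ B) (u v : ι → ℝ) :
    ∑ i, ∑ j, |u i| * K i j * |v j| ≤ B * Real.sqrt (∑ i, u i ^ 2) * Real.sqrt (∑ j, v j ^ 2) := by
  classical
  set A : ℝ := ∑ i, ∑ j, |u i| * K i j * |v j| with hA
  have hA0 : 0 ≤ A := Finset.sum_nonneg fun i _ => Finset.sum_nonneg fun j _ =>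
    mul_nonneg (mul_nonneg (abs_nonneg _) (hK i j)) (abs_nonneg _)
  -- Cauchy–Schwarz over the pairs `(i, j)`
  have hCS : A ^ 2 ≤ (∑ p : ι × ι, u p.1 ^ 2 * K p.1 p.2) * (∑ p : ι × ι, K p.1 p.2 * v p.2 ^ 2) := by
    have hA' : A = ∑ p : ι × ι, (|u p.1| * Real.sqrt (K p.1 p.2)) * (Real.sqrt (K p.1 p.2) * |v p.2|) := by
      rw [hA, Fintype.sum_prod_type]
      refine Finset.sum_congr rfl fun i _ => Finset.sum_congr rfl fun j _ => ?_
      have hs : Real.sqrt (K i j) * Real.sqrt (K i j) = K i j := Real.mul_self_sqrt (hK _ _)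
      calc |u i| * K i j * |v j| = |u i| * (Real.sqrt (K i j) * Real.sqrt (K i j)) * |v j| := by rw [hs]
        _ = |u i| * Real.sqrt (K i j) * (Real.sqrt (K i j) * |v j|) := by ring
    rw [hA']
    refine (Finset.sum_mul_sq_le_sq_mul_sq _ _ _).trans (le_of_eq ?_)
    congr 1
    · refine Finset.sum_congr rfl fun p _ => ?_
      rw [mul_pow, sq_abs, Real.sq_sqrt (hK _ _)]
    · refine Finset.sum_congr rfl fun p _ => ?_
      rw [mul_pow, sq_abs, Real.sq_sqrt (hK _ _)]
  -- row and column sums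
  have h1 : ∑ p : ι × ι, u p.1 ^ 2 * K p.1 p.2 ≤ B * ∑ i, u i ^ 2 := by
    rw [Fintype.sum_prod_type, Finset.mul_sum]
    refine Finset.sum_le_sum fun i _ => ?_
    dsimp only
    rw [← Finset.mul_sum, mul_comm B]
    exact mul_le_mul_of_nonneg_left (hrow i) (sq_nonneg _)
  have h2 : ∑ p : ι × ι, K p.1 p.2 * v p.2 ^ 2 ≤ B * ∑ j, v j ^ 2 := by
    rw [Fintype.sum_prod_type, Finset.sum_comm, Finset.mul_sum]
    refine Finset.sum_le_sum fun j _ => ?_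
    dsimp only
    rw [← Finset.sum_mul]
    exact mul_le_mul_of_nonneg_right (hcol j) (sq_nonneg _)
  have hu : 0 ≤ ∑ i, u i ^ 2 := Finset.sum_nonneg fun i _ => sq_nonneg _
  have hv : 0 ≤ ∑ j, v j ^ 2 := Finset.sum_nonneg fun j _ => sq_nonneg _
  have hsq : A ^ 2 ≤ (B * Real.sqrt (∑ i, u i ^ 2) * Real.sqrt (∑ j, v j ^ 2)) ^ 2 := by
    calc A ^ 2 ≤ (B * ∑ i, u i ^ 2) * (B * ∑ j, v j ^ 2) :=
          hCS.trans (mul_le_mul h1 h2 (Finset.sum_nonneg fun p _ => mul_nonneg (hK _ _) (sq_nonneg _)) (by positivity))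
      _ = (B * Real.sqrt (∑ i, u i ^ 2) * Real.sqrt (∑ j, v j ^ 2)) ^ 2 := by
          rw [mul_pow, mul_pow, Real.sq_sqrt hu, Real.sq_sqrt hv]; ring
  have hR : 0 ≤ B * Real.sqrt (∑ i, u i ^ 2) * Real.sqrt (∑ j, v j ^ 2) := by positivity
  exact (pow_le_pow_iff_left₀ hA0 hR two_ne_zero).1 hsq

/-- A row of a kernel restricted to the support of `w` is bounded by the sup-norm operator bound on test functions `|f| ≦ 1`
supported in `supp w` (take `f = sign G(z,·)·1_{supp w}`): the reduction *"it is enough to prove it for f, f′ with supports in unit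
cubes, and the proof proceeds as before using only the L²-bounds"*. [cite: Balaban1983RegularityDecay, Corollary 2.3 (2.30) p.580] -/
theorem rowSum_abs_le {ι : Type*} [Fintype ι] (G : Matrix ι ι ℝ) (w : ι → ℝ) (z : ι) {B : ℝ}
    (hG : ∀ f : ι → ℝ, (∀ z', |f z'| ≤ 1) → (∀ z', f z' ≠ 0 → w z' ≠ 0) → |(G *ᵥ f) z| ≤ B) :
    ∑ z', (if w z' ≠ 0 then |G z z'| else 0) ≤ B := by
  classical
  let f : ι → ℝ := fun z' => if w z' = 0 then 0 else (if 0 ≤ G z z' then 1 else -1)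
  have h1 : ∀ z', |f z'| ≤ 1 := by
    intro z'
    dsimp only [f]
    split_ifs <;> simp
  have h2 : ∀ z', f z' ≠ 0 → w z' ≠ 0 := by
    intro z' hz hw
    exact hz (by simp [f, hw])
  have h3 : (G *ᵥ f) z = ∑ z', (if w z' ≠ 0 then |G z z'| else 0) := by
    simp only [Matrix.mulVec, dotProduct]
    refine Finset.sum_congr rfl fun z' _ => ?_
    dsimp only [f]
    by_cases hw : w z' = 0
    · simp [hw]
    · by_cases hs : 0 ≤ G z z'
      · simp [hw, hs, abs_of_nonneg hs]
      · simp [hw, hs, abs_of_neg (lt_of_not_ge hs)]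
  calc ∑ z', (if w z' ≠ 0 then |G z z'| else 0) = (G *ᵥ f) z := h3.symm
    _ ≤ |(G *ᵥ f) z| := le_abs_self _
    _ ≤ B := hG f h1 h2

/-- **Schur's test for the pairing `⟨u, Gv⟩` with support-localised row and column bounds**: if every row of `|G|` through `supp u`,
summed over `supp v`, and every column through `supp v`, summed over `supp u`, is `≦ B`, then `|⟨u, Gv⟩| ≦ B‖u‖₂‖v‖₂`.
[cite: Balaban1983RegularityDecay, Corollary 2.3 (2.30) p.580] -/
theorem abs_dot_mulVec_le {ι : Type*} [Fintype ι] (G : Matrix ι ι ℝ) (u v : ι → ℝ) {B : ℝ} (hB : 0 ≤ B)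
    (hrow : ∀ z, u z ≠ 0 → ∑ z', (if v z' ≠ 0 then |G z z'| else 0) ≤ B)
    (hcol : ∀ z', v z' ≠ 0 → ∑ z, (if u z ≠ 0 then |G z z'| else 0) ≤ B) :
    |u ⬝ᵥ (G *ᵥ v)| ≤ B * Real.sqrt (∑ z, u z ^ 2) * Real.sqrt (∑ z, v z ^ 2) := by
  classical
  let K : ι → ι → ℝ := fun z z' => if u z ≠ 0 ∧ v z' ≠ 0 then |G z z'| else 0
  have hK : ∀ z z', 0 ≤ K z z' := by
    intro z z'
    dsimp only [K]
    split_ifs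
    · exact abs_nonneg _
    · exact le_rfl
  have hrowK : ∀ z, ∑ z', K z z' ≤ B := by
    intro z
    by_cases hz : u z = 0
    · have h0 : ∀ z', K z z' = 0 := fun z' => by simp [K, hz]
      simp only [h0, Finset.sum_const_zero]
      exact hB
    · have h0 : ∀ z', K z z' = if v z' ≠ 0 then |G z z'| else 0 := fun z' => by simp [K, hz]
      simp only [h0]
      exact hrow z hz
  have hcolK : ∀ z', ∑ z, K z z' ≤ B := by
    intro z'
    by_cases hz' : v z' = 0
    · have h0 : ∀ z, K z z' = 0 := fun z => by simp [K, hz']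
      simp only [h0, Finset.sum_const_zero]
      exact hB
    · have h0 : ∀ z, K z z' = if u z ≠ 0 then |G z z'| else 0 := fun z => by simp [K, hz']
      simp only [h0]
      exact hcol z' hz'
  have hterm : ∀ z z', |u z| * |G z z'| * |v z'| = |u z| * K z z' * |v z'| := by
    intro z z'
    dsimp only [K]
    by_cases hz : u z = 0
    · simp [hz]
    · by_cases hz' : v z' = 0
      · simp [hz']
      · simp [hz, hz']
  calc |u ⬝ᵥ (G *ᵥ v)| = |∑ z, ∑ z', u z * G z z' * v z'| := by
        simp only [dotProduct, Matrix.mulVec, Finset.mul_sum, mul_assoc]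
    _ ≤ ∑ z, ∑ z', |u z| * K z z' * |v z'| := by
        refine (Finset.abs_sum_le_sum_abs _ _).trans (Finset.sum_le_sum fun z _ =>
          (Finset.abs_sum_le_sum_abs _ _).trans (Finset.sum_le_sum fun z' _ => ?_))
        rw [abs_mul, abs_mul, hterm]
    _ ≤ B * Real.sqrt (∑ z, u z ^ 2) * Real.sqrt (∑ z, v z ^ 2) := abs_sum_mul_le_of_rowcol K hK hB hrowK hcolK u v

end Schur

end Literature.MathematicalPhysics.QuantumFieldTheory.Balaban1983to89.B1Ineq225ZeroFieldTorusLevels
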